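import Literature.MathematicalPhysics.QuantumFieldTheory.WilsonFinTorusTwistTensor
import HarnessLib

/-!
# Central link translations on the anisotropic `Fin`-box: the plaquette coboundary and the invariance of the twisted
# Wilson integral (`Z^{c} = Z^{c·δλ}`)

Topic `Literature/MathematicalPhysics/QuantumFieldTheory`; companion of `WilsonFinTorusTwistTensor.lean` (the Wilson integral
`wilsonFinTorusPlaqTwistedPartition ρ β n₀ n₁ n₂ n₃ c` of the box `n₀ × n₁ × n₂ × n₃` with an arbitrary plaquette cochain
`c : FinTorusSite → Fin 4 → Fin 4 → G` inserted, `finTorusPlaquette`, `FinTorusSite.shift`).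

't Hooft's twisted partition functions depend on the twist cochain only through its cohomology class: multiplying every link
variable by a CENTRAL element, `U_ℓ ↦ λ_ℓ U_ℓ`, is a change of variables preserving the product Haar measure, and it multiplies
each plaquette variable by the coboundary `(δλ)(x; μ, ν) = λ(x,μ) λ(x+μ̂,ν) λ(x+ν̂,μ)⁻¹ λ(x,ν)⁻¹` (G. 't Hooft, Nucl. Phys. B 153
(1979) 141, §2 after (2.6): the twist may be moved by «a gauge transformation which is multivalued by elements of the centre»;
J. Greensite, *An Introduction to the Confinement Problem* (2011) §4.4 (4.41)–(4.43): moving the stack of twisted plaquettes;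
T. Kanazawa, Ann. Phys. 324 (2009) 1634, §2 Lemma 1 eq. (11): the coboundary substitution).  PROVED here, for every group `G`
and every box (no continuity, no centrality of the cochain `c` itself):

* `finLinkCoboundary lam x μ ν` — the plaquette coboundary `δλ` of a link field `λ` (a DEFINITION);
* `finTorusPlaquette_mul_of_mem_center` — for centre-valued `λ`: `U_{x,μν}(λ·U) = (δλ)(x;μ,ν) · U_{x,μν}(U)`;
  `finTorusPlaquette_mul_comm` — the same for a commutative `G` with no hypothesis;
* `measurePreserving_finLinkMul` — `U ↦ λ·U` preserves `∏_ℓ dHaar(U_ℓ)` (left invariance, link by link);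
* ★ `wilsonFinTorusPlaqTwistedPartition_mul_coboundary` — **`Z^{c} = Z^{c·δλ}`** for every cochain `c`, every centre-valued
  link field `λ`, every compact `G`, every `ρ`, `β`.

HONEST FRAMING: a change of variables; nothing here chooses a useful `λ` (the spreading ∕ stack-moving fields of the consumers),
estimates anything, or bears on confinement or a mass gap.  The abelian special case with an explicit spreading field is the
Summits-side `MagneticFluxCeilingAbelianWitnessSpread.lean`.

References: G. 't Hooft, Nucl. Phys. B 153 (1979) 141, §2; J. Greensite (2011) §4.4; T. Kanazawa, Ann. Phys. 324 (2009) 1634,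
§2 Lemma 1; I. Montvay, G. Münster, *Quantum Fields on a Lattice* (1994) §3.2 (3.90) (invariance of the Haar measure).
-/

noncomputable section

open MeasureTheory

namespace Literature.MathematicalPhysics.QuantumFieldTheory

section Algebra

variable {G : Type*} [Group G] {n₀ n₁ n₂ n₃ : ℕ}

/-- **The plaquette coboundary of a link field** `λ`: `(δλ)(x; μ, ν) = λ(x,μ) λ(x+μ̂,ν) λ(x+ν̂,μ)⁻¹ λ(x,ν)⁻¹` — the factor by which
the plaquette variable `U_{x,μν} = U(x,μ) U(x+μ̂,ν) U(x+ν̂,μ)⁻¹ U(x,ν)⁻¹` changes under `U_ℓ ↦ λ_ℓ U_ℓ` when the `λ_ℓ` are central.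
[cite: Kanazawa2008, §2 Lemma 1 eq. (11)] [cite: Greensite2011, §4.4 (4.41)–(4.43)] -/
def finLinkCoboundary (lam : FinTorusSite n₀ n₁ n₂ n₃ × Fin 4 → G) (x : FinTorusSite n₀ n₁ n₂ n₃) (μ ν : Fin 4) : G :=
  lam (x, μ) * lam (x.shift μ, ν) * (lam (x.shift ν, μ))⁻¹ * (lam (x, ν))⁻¹

/-- Unfolding lemma. [cite: Kanazawa2008, §2 Lemma 1 eq. (11)] -/
theorem finLinkCoboundary_def (lam : FinTorusSite n₀ n₁ n₂ n₃ × Fin 4 → G) (x : FinTorusSite n₀ n₁ n₂ n₃) (μ ν : Fin 4) :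
    finLinkCoboundary lam x μ ν = lam (x, μ) * lam (x.shift μ, ν) * (lam (x.shift ν, μ))⁻¹ * (lam (x, ν))⁻¹ := rfl

/-- The trivial link field has trivial coboundary. [cite: Kanazawa2008, §2 Lemma 1 eq. (11)] -/
theorem finLinkCoboundary_one (x : FinTorusSite n₀ n₁ n₂ n₃) (μ ν : Fin 4) :
    finLinkCoboundary (fun _ : FinTorusSite n₀ n₁ n₂ n₃ × Fin 4 => (1 : G)) x μ ν = 1 := by
  simp [finLinkCoboundary]

/-- **Central link translations multiply the plaquette variable by the coboundary**:
`U_{x,μν}(λ·U) = (δλ)(x; μ, ν) · U_{x,μν}(U)` when every `λ_ℓ` is central. [cite: tHooft1979Flux, §2 (after eq. (2.6))]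
[cite: Kanazawa2008, §2 Lemma 1 eq. (11)] -/
theorem finTorusPlaquette_mul_of_mem_center {lam : FinTorusSite n₀ n₁ n₂ n₃ × Fin 4 → G}
    (hlam : ∀ l, lam l ∈ Subgroup.center G) (U : FinTorusSite n₀ n₁ n₂ n₃ × Fin 4 → G) (x : FinTorusSite n₀ n₁ n₂ n₃)
    (μ ν : Fin 4) :
    finTorusPlaquette (fun l => lam l * U l) x μ ν = finLinkCoboundary lam x μ ν * finTorusPlaquette U x μ ν := by
  have hc : ∀ (l : FinTorusSite n₀ n₁ n₂ n₃ × Fin 4) (g : G), g * lam l = lam l * g := fun l g =>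
    Subgroup.mem_center_iff.1 (hlam l) g
  have hci : ∀ (l : FinTorusSite n₀ n₁ n₂ n₃ × Fin 4) (g : G), g * (lam l)⁻¹ = (lam l)⁻¹ * g := fun l g =>
    Subgroup.mem_center_iff.1 (Subgroup.inv_mem _ (hlam l)) g
  -- bubble the central factors to the left, one at a time
  have hcl : ∀ (l : FinTorusSite n₀ n₁ n₂ n₃ × Fin 4) (g h : G), g * (lam l * h) = lam l * (g * h) := fun l g h => by
    rw [← mul_assoc, hc, mul_assoc]
  have hcil : ∀ (l : FinTorusSite n₀ n₁ n₂ n₃ × Fin 4) (g h : G), g * ((lam l)⁻¹ * h) = (lam l)⁻¹ * (g * h) := fun l g h => by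
    rw [← mul_assoc, hci, mul_assoc]
  simp only [finTorusPlaquette, finLinkCoboundary, mul_inv_rev, mul_assoc]
  rw [hcl (x.shift μ, ν) (U (x, μ))]
  rw [hcil (x.shift ν, μ) ((U (x.shift ν, μ))⁻¹), hcil (x.shift ν, μ) (U (x.shift μ, ν)), hcil (x.shift ν, μ) (U (x, μ))]
  rw [hci (x, ν) ((U (x, ν))⁻¹), hcil (x, ν) ((U (x.shift ν, μ))⁻¹), hcil (x, ν) (U (x.shift μ, ν)),
    hcil (x, ν) (U (x, μ))]

/-- Commutative groups: the same identity with no hypothesis. [cite: Kanazawa2008, §2 Lemma 1 eq. (11)] -/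
theorem finTorusPlaquette_mul_comm {G : Type*} [CommGroup G] {n₀ n₁ n₂ n₃ : ℕ}
    (lam U : FinTorusSite n₀ n₁ n₂ n₃ × Fin 4 → G) (x : FinTorusSite n₀ n₁ n₂ n₃) (μ ν : Fin 4) :
    finTorusPlaquette (fun l => lam l * U l) x μ ν = finLinkCoboundary lam x μ ν * finTorusPlaquette U x μ ν :=
  finTorusPlaquette_mul_of_mem_center (fun l => Subgroup.mem_center_iff.2 fun g => mul_comm g (lam l)) U x μ ν

end Algebra

section Measure

variable {G : Type*} [Group G] [TopologicalSpace G] [IsTopologicalGroup G] [CompactSpace G] [MeasurableSpace G]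
  [BorelSpace G] {n₀ n₁ n₂ n₃ : ℕ}

/-- **Link-wise left translation preserves the product Haar measure** `∏_ℓ dHaar(U_ℓ)` of the box (any link field `λ`,
central or not). [cite: MontvayMunster1994, §3.2 (3.90)] -/
theorem measurePreserving_finLinkMul (lam : FinTorusSite n₀ n₁ n₂ n₃ × Fin 4 → G) :
    MeasurePreserving (fun (U : FinTorusSite n₀ n₁ n₂ n₃ × Fin 4 → G) l => lam l * U l)
      (Measure.pi fun _ : FinTorusSite n₀ n₁ n₂ n₃ × Fin 4 => haarProbability G)
      (Measure.pi fun _ : FinTorusSite n₀ n₁ n₂ n₃ × Fin 4 => haarProbability G) :=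
  measurePreserving_pi (f := fun (l : FinTorusSite n₀ n₁ n₂ n₃ × Fin 4) (g : G) => lam l * g)
    (fun _ => haarProbability G) (fun _ => haarProbability G)
    fun l => measurePreserving_mul_left (haarProbability G) (lam l)

variable {N : ℕ} (ρ : G →* Matrix (Fin N) (Fin N) ℂ)

omit [CompactSpace G] [MeasurableSpace G] [BorelSpace G] in
/-- The twisted Wilson integrand is continuous in the configuration (plumbing). [cite: MontvayMunster1994, §3.2.2 (3.65)] -/
theorem continuous_plaqTwistedWeight (hρ : Continuous ρ) (β : ℝ) (c : FinTorusSite n₀ n₁ n₂ n₃ → Fin 4 → Fin 4 → G) :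
    Continuous fun U : FinTorusSite n₀ n₁ n₂ n₃ × Fin 4 → G =>
      Real.exp (-β * ∑ x : FinTorusSite n₀ n₁ n₂ n₃, ∑ q : {q : Fin 4 × Fin 4 // q.1 < q.2},
        ((N : ℝ) - (ρ (c x q.1.1 q.1.2 * finTorusPlaquette U x q.1.1 q.1.2)).trace.re)) := by
  have hpl : ∀ (x : FinTorusSite n₀ n₁ n₂ n₃) (μ ν : Fin 4),
      Continuous fun U : FinTorusSite n₀ n₁ n₂ n₃ × Fin 4 → G => finTorusPlaquette U x μ ν := fun x μ ν => by
    unfold finTorusPlaquette; fun_prop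
  have htr : Continuous fun g : G => (ρ g).trace.re := Complex.continuous_re.comp (Continuous.matrix_trace hρ)
  exact Real.continuous_exp.comp (continuous_const.mul (continuous_finsetSum _ fun x _ =>
    continuous_finsetSum _ fun q _ => continuous_const.sub (htr.comp (continuous_const.mul (hpl x _ _)))))

/-- ★ **`Z^{c} = Z^{c·δλ}`: the twisted Wilson integral is unchanged when the cochain is multiplied by the coboundary of a
centre-valued link field** (change of variables `U ↦ λ·U`; every box, every compact `G`, continuous `ρ`, real `β`).
[cite: tHooft1979Flux, §2 (after eq. (2.6))] [cite: Kanazawa2008, §2 Lemma 1 eq. (11)] [cite: Greensite2011, §4.4 (4.41)–(4.43)] -/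
theorem wilsonFinTorusPlaqTwistedPartition_mul_coboundary [SecondCountableTopology G] (hρ : Continuous ρ) (β : ℝ)
    (c : FinTorusSite n₀ n₁ n₂ n₃ → Fin 4 → Fin 4 → G) {lam : FinTorusSite n₀ n₁ n₂ n₃ × Fin 4 → G}
    (hlam : ∀ l, lam l ∈ Subgroup.center G) :
    wilsonFinTorusPlaqTwistedPartition ρ β n₀ n₁ n₂ n₃ c =
      wilsonFinTorusPlaqTwistedPartition ρ β n₀ n₁ n₂ n₃ (fun x μ ν => c x μ ν * finLinkCoboundary lam x μ ν) := by
  have hT := measurePreserving_finLinkMul (n₀ := n₀) (n₁ := n₁) (n₂ := n₂) (n₃ := n₃) lam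
  have hF := continuous_plaqTwistedWeight (n₀ := n₀) (n₁ := n₁) (n₂ := n₂) (n₃ := n₃) ρ hρ β c
  have h := integral_map hT.measurable.aemeasurable
    (hF.aestronglyMeasurable (μ := Measure.map _ (Measure.pi fun _ : FinTorusSite n₀ n₁ n₂ n₃ × Fin 4 => haarProbability G)))
  rw [hT.map_eq] at h
  unfold wilsonFinTorusPlaqTwistedPartition
  rw [h]
  refine integral_congr_ae (ae_of_all _ fun U => ?_)
  simp only [finTorusPlaquette_mul_of_mem_center hlam, mul_assoc]

end Measure

end Literature.MathematicalPhysics.QuantumFieldTheory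

end
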